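import Mathlib
import Summits.MatrixMultiplication.MatrixMultiplication.Theses.MatrixPointInterpolation
import Summits.MatrixMultiplication.MatrixMultiplication.Theorems.TightWindows.Negative.FewLetters

/-!
# `MatrixPointInterpolation.TightWindows` (stmt-MatrixMultiplication-18939) — Negative lane:
# the five-point corner pair, part 3: masquerade at point size 5 and the loose window

Helpers (no Theses conclusion, no new definition) for the unconditional refutation
`MatrixPointInterpolationTightWindows_refuted`:

* `masquerade_of_gap_law`: a pair with the gap-law vanishing at point size `5` (part 1,
  `corner_pair_exists`) masquerades as `M₅(ℂ)` to degree `2·(2(m+1))` — split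
  `Σ_{w ∈ T} c_w w(A)` termwise: `c_w = 0` when `#₁(w) < 5` (few letters, part 2,
  `coeff_eq_zero_of_count_lt`), `w(A) = 0` when `#₁(w) ≥ 5` and `|w| ≤ 4(m+1)`.
* `window_finrank_ge`: the window at `k = 5`, `d = 2(m+1)` has dimension `≥ (m+1)⁴` — the word
  functions `B ↦ (x^{a₀} y x^{a₁} y x^{a₂} y x^{a₃} y)(B)`, `aᵢ ≤ m` (length `≤ 4(m+1)`), are
  linearly independent on `M₅(ℂ)²` (a linear relation is an identity of `M₅` supported on words
  with four letters `1`, so few letters kills it; the words are recovered from their blocks).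
-/

namespace Summit.MatrixMultiplication.MatrixMultiplication.Theorems

open scoped BigOperators

namespace TightWindowsNeg

/-- A pair with the gap-law vanishing at point size `5` (every word with `≥ 5` letters `1` and
length `≤ 4(m+1)` vanishes) masquerades as `M₅(ℂ)` to degree `2·(2(m+1))`. -/
theorem masquerade_of_gap_law (m : ℕ) (A : Fin 2 → Matrix (Fin (m + 1)) (Fin (m + 1)) ℂ)
    (hA : ∀ (k : ℕ) (w : List (Fin 2)), 1 ≤ k → k ≤ w.count 1 → w.length ≤ (k - 1) * (m + 1) →
      (w.map A).prod = 0)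
    (T : Finset (List (Fin 2))) (c : List (Fin 2) → ℂ)
    (hT : ∀ w ∈ T, w.length ≤ 2 * (2 * (m + 1)))
    (hid : ∀ B : Fin 2 → Matrix (Fin 5) (Fin 5) ℂ, (∑ w ∈ T, c w • (w.map B).prod) = 0) :
    (∑ w ∈ T, c w • (w.map A).prod) = 0 := by
  apply Finset.sum_eq_zero
  intro w hw
  by_cases hc : w.count 1 < 5
  · rw [coeff_eq_zero_of_count_lt 5 T c hid w hw hc, zero_smul]
  · have hl := hT w hw
    rw [hA 5 w (by norm_num) (by omega) (by omega), smul_zero]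

/-- The window at `k = 5`, `d = 2(m+1)` has dimension `≥ (m+1)⁴`: the word functions
`B ↦ (x^{a₀} y x^{a₁} y x^{a₂} y x^{a₃} y)(B)`, `aᵢ ≤ m`, are linearly independent on `M₅(ℂ)²`. -/
theorem window_finrank_ge (m : ℕ) :
    (m + 1) ^ 4 ≤ Module.finrank ℂ (Submodule.span ℂ
      {f : (Fin 2 → Matrix (Fin 5) (Fin 5) ℂ) → Matrix (Fin 5) (Fin 5) ℂ |
        ∃ w : List (Fin 2), w.length ≤ 2 * (2 * (m + 1)) ∧ f = fun B => (w.map B).prod}) := by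
  classical
  -- the quad words `x^{a₀} y x^{a₁} y x^{a₂} y x^{a₃} y` and their block decoder
  let qw : (Fin 4 → Fin (m + 1)) → List (Fin 2) := fun a =>
    List.replicate (a 0) 0 ++ (1 :: (List.replicate (a 1) 0 ++ (1 :: (List.replicate (a 2) 0 ++
      (1 :: (List.replicate (a 3) 0 ++ [1]))))))
  let blocks : List (Fin 2) → ℕ × List ℕ := fun w =>
    w.foldr (fun l p => if l = 0 then (p.1 + 1, p.2) else (0, p.1 :: p.2)) (0, [])
  have qw_length : ∀ a, (qw a).length ≤ 2 * (2 * (m + 1)) := by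
    intro a
    have h0 := (a 0).is_lt; have h1 := (a 1).is_lt; have h2 := (a 2).is_lt; have h3 := (a 3).is_lt
    simp only [qw, List.length_append, List.length_replicate, List.length_cons, List.length_nil]
    omega
  have qw_count : ∀ a, (qw a).count 1 = 4 := by
    intro a
    simp [qw, List.count_replicate]
  have blocks_nil : blocks [] = (0, []) := rfl
  have blocks_zero_cons : ∀ v, blocks (0 :: v) = ((blocks v).1 + 1, (blocks v).2) := fun v => by
    simp [blocks]
  have blocks_one_cons : ∀ v, blocks (1 :: v) = (0, (blocks v).1 :: (blocks v).2) := fun v => by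
    simp [blocks]
  have blocks_replicate_append : ∀ (n : ℕ) (v : List (Fin 2)),
      blocks (List.replicate n 0 ++ v) = ((blocks v).1 + n, (blocks v).2) := by
    intro n v
    induction n with
    | zero => simp
    | succ n ih =>
      rw [List.replicate_succ, List.cons_append, blocks_zero_cons, ih]
      simp only [Prod.mk.injEq, and_true]
      omega
  have blocks_qw : ∀ a, blocks (qw a) = ((a 0 : ℕ), [(a 1 : ℕ), (a 2 : ℕ), (a 3 : ℕ), 0]) := by
    intro a
    simp only [qw, blocks_replicate_append, blocks_one_cons, blocks_nil, zero_add]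
  have qw_injective : Function.Injective qw := by
    intro a b h
    have hb := congrArg blocks h
    rw [blocks_qw, blocks_qw] at hb
    simp only [Prod.mk.injEq, List.cons.injEq, and_true] at hb
    obtain ⟨h0, h1, h2, h3⟩ := hb
    funext i
    fin_cases i
    · exact Fin.ext h0
    · exact Fin.ext h1
    · exact Fin.ext h2
    · exact Fin.ext h3
  -- the quad word functions are linearly independent (few letters at `k = 5`)
  let qf : (Fin 4 → Fin (m + 1)) → (Fin 2 → Matrix (Fin 5) (Fin 5) ℂ) → Matrix (Fin 5) (Fin 5) ℂ :=
    fun a B => ((qw a).map B).prod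
  have hli : LinearIndependent ℂ qf := by
    rw [Fintype.linearIndependent_iff]
    intro g hg a₀
    let T : Finset (List (Fin 2)) := Finset.univ.image qw
    let c : List (Fin 2) → ℂ := fun w => if h : ∃ a, qw a = w then g h.choose else 0
    have hc : ∀ a, c (qw a) = g a := by
      intro a
      have h : ∃ a', qw a' = qw a := ⟨a, rfl⟩
      simp only [c, dif_pos h]
      rw [qw_injective h.choose_spec]
    have hid : ∀ B : Fin 2 → Matrix (Fin 5) (Fin 5) ℂ, (∑ w ∈ T, c w • (w.map B).prod) = 0 := by
      intro B
      rw [Finset.sum_image (fun x _ y _ hxy => qw_injective hxy)]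
      have := congr_fun hg B
      simp only [Finset.sum_apply, Pi.smul_apply, Pi.zero_apply] at this
      simpa only [hc, qf] using this
    have h := coeff_eq_zero_of_count_lt 5 T c hid (qw a₀)
      (Finset.mem_image.2 ⟨a₀, Finset.mem_univ _, rfl⟩) (by rw [qw_count]; norm_num)
    rwa [hc] at h
  -- hence the window is at least `(m+1)⁴`-dimensional
  set S := {f : (Fin 2 → Matrix (Fin 5) (Fin 5) ℂ) → Matrix (Fin 5) (Fin 5) ℂ |
        ∃ w : List (Fin 2), w.length ≤ 2 * (2 * (m + 1)) ∧ f = fun B => (w.map B).prod} with hS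
  have hfin : S.Finite := by
    have : S = (fun w : List (Fin 2) => fun B : Fin 2 → Matrix (Fin 5) (Fin 5) ℂ => (w.map B).prod) ''
        {w : List (Fin 2) | w.length ≤ 2 * (2 * (m + 1))} := by
      ext f
      simp only [hS, Set.mem_setOf_eq, Set.mem_image]
      constructor
      · rintro ⟨w, hw, rfl⟩; exact ⟨w, hw, rfl⟩
      · rintro ⟨w, hw, rfl⟩; exact ⟨w, hw, rfl⟩
    rw [this]
    exact (List.finite_length_le (Fin 2) _).image _
  haveI : FiniteDimensional ℂ (Submodule.span ℂ S) := FiniteDimensional.span_of_finite ℂ hfin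
  have hmem : ∀ a, qf a ∈ Submodule.span ℂ S := fun a =>
    Submodule.subset_span ⟨qw a, qw_length a, rfl⟩
  let v : (Fin 4 → Fin (m + 1)) → Submodule.span ℂ S := fun a => ⟨qf a, hmem a⟩
  have hv : LinearIndependent ℂ v := by
    apply LinearIndependent.of_comp (Submodule.span ℂ S).subtype
    exact hli
  have := hv.fintype_card_le_finrank
  simpa [Fintype.card_fun, Fintype.card_fin] using this

end TightWindowsNeg

end Summit.MatrixMultiplication.MatrixMultiplication.Theorems
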